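import Mathlib
import Summits.Ventures.PercRepro2.UniversalSeriesFibresDefs
import Summits.Ventures.PercRepro2.RelayClosures

/-! # The level-aligned package (Package-L) of (UH*): definition, the series assignment and its cases
(seat mine-b, cell pub-perc-repro2; MINE-B.md §29)

A **level-aligned package** on a finite labelled preorder `(X, ≤, r, b)` is a (UH*) assignment `f`
together with a family of *level relays*: for every `k`, `α k` is injective on `{b > k}`, downward, red
`≥ 1`, blue drop `≤ 1`, and avoids every `f`-image of a slot of index `< k`; `α 0` (the relay `Σ`) agrees
with `f` on the slot `0` of every source; and `β k` is the same on the red-positive elements `{r ≥ 1, b > k}`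
avoiding the slots of index `≤ k`.  It is the package of MINE-B.md §28.10 with the fibre index forced equal
to the unit index (`ΦA_m (z, k) = (k, α k z)`, `ΦB_m (u, k) = (k, β k u)`) and the drop condition made
independent of `m`.

The point of the alignment: the package is closed under series composition COORDINATEWISE
(UniversalAlignedSer.lean) and under parallel composition by a three-family rule (UniversalAlignedPar.lean);
the atoms carry it trivially; hence every series–parallel term carries it, and its first component is (UH*)
(UniversalAlignedSP.lean).  Exact census: the package exists on all 809 free-edge SP cubes with ≤ 8 edges
(kit j274119, SAT 809 / UNSAT 0, witnesses re-verified).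

This file: the structure `PackageL`, its two immediate consequences (`PackageL.universal`,
`PackageL.relay`), and the series assignment `serAssignL` with its three kinds (`AlKind`) and case lemmas:
the slot of index `0` of a product source `(u, v)` goes to `(α 0 u, α 0 v)`; the slot of index `k ≥ 1` of
`(x, z)` with `x` a source of `X` goes to `(f (x, k), α k z)`; the slot of index `k ≥ 1` of `(u, z)` with
`u` red-positive (so `z` a source of `Y`) goes to `(β k u, g (z, k))`. -/

namespace Summit.Ventures.PercRepro2.UHClosure

open Finset
open Summit.Ventures.PercRepro2.V2Closure (serR serB IsRelay)

variable {X Y : Type*} [Preorder X] [Preorder Y] [Fintype X] [Fintype Y]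

/-- **the level-aligned package** of (UH*) on a labelled preorder -/
structure PackageL (r b : X → ℕ) where
  /-- the (UH*) assignment -/
  f : SlotL (USrc r b) b → X
  /-- `f` is injective -/
  f_inj : Function.Injective f
  /-- `f` is below its source, has red label `1` and blue drop `≤ 1` -/
  f_spec : ∀ p : SlotL (USrc r b) b, f p ≤ p.1.1.1 ∧ r (f p) = 1 ∧ b p.1.1.1 ≤ b (f p) + 1
  /-- the level relays `α k` on `{b > k}`; `α 0` is the relay `Σ` -/
  α : ℕ → X → X
  /-- `α k` is injective on `{b > k}` -/
  α_inj : ∀ k z z', k < b z → k < b z' → α k z = α k z' → z = z'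
  /-- `α k` is downward, red `≥ 1`, blue drop `≤ 1` -/
  α_spec : ∀ k z, k < b z → α k z ≤ z ∧ 1 ≤ r (α k z) ∧ b z ≤ b (α k z) + 1
  /-- `α k` avoids the `f`-images of the slots of index `< k` -/
  α_avoid : ∀ k z, k < b z → ∀ p : SlotL (USrc r b) b, p.1.2.val < k → α k z ≠ f p
  /-- `α 0` agrees with `f` on the slot `0` of every source -/
  α_src : ∀ p : SlotL (USrc r b) b, p.1.2.val = 0 → α 0 p.1.1.1 = f p
  /-- the level relays `β k` on the red-positive elements `{r ≥ 1, b > k}` -/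
  β : ℕ → X → X
  /-- `β k` is injective on `{r ≥ 1, b > k}` -/
  β_inj : ∀ k u u', 1 ≤ r u → k < b u → 1 ≤ r u' → k < b u' → β k u = β k u' → u = u'
  /-- `β k` is downward, red `≥ 1`, blue drop `≤ 1` -/
  β_spec : ∀ k u, 1 ≤ r u → k < b u → β k u ≤ u ∧ 1 ≤ r (β k u) ∧ b u ≤ b (β k u) + 1
  /-- `β k` avoids the `f`-images of the slots of index `≤ k` -/
  β_avoid : ∀ k u, 1 ≤ r u → k < b u → ∀ p : SlotL (USrc r b) b, p.1.2.val ≤ k → β k u ≠ f p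

variable {r b : X → ℕ} {r' b' : Y → ℕ}

/-- the first component of a package is (UH*) -/
theorem PackageL.universal (P : PackageL r b) : Universal r b := ⟨P.f, P.f_inj, P.f_spec⟩

/-- `α 0` is a relay (`IsRelay`: injective on the blue-positive elements, below, red `≥ 1`, drop `≤ 1`) -/
theorem PackageL.relay (P : PackageL r b) : IsRelay r b (P.α 0) :=
  ⟨fun z z' hz hz' h => P.α_inj 0 z z' hz hz' h, fun z hz => P.α_spec 0 z hz⟩

/-! ### The series assignment and its kinds -/

section series

variable (r b r' b')

/-- the kinds of a product slot of the series product: index `0`; index `≥ 1` with a source first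
coordinate; index `≥ 1` with a red-positive first coordinate -/
inductive AlKind where
  | zero | src | int
  deriving DecidableEq

/-- the kind of a product slot -/
def alKind (q : SlotL (USrc (serR r r') (serB b b')) (serB b b')) : AlKind :=
  if q.1.2.val = 0 then .zero else if r q.1.1.1.1 = 0 then .src else .int

omit [Preorder X] [Preorder Y] in
/-- what kind `zero` means -/
lemma alKind_zero {q : SlotL (USrc (serR r r') (serB b b')) (serB b b')} (h : alKind r b r' b' q = .zero) :
    q.1.2.val = 0 := by
  unfold alKind at h
  split_ifs at h with h1 h2
  exact h1

omit [Preorder X] [Preorder Y] in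
/-- what kind `src` means -/
lemma alKind_src {q : SlotL (USrc (serR r r') (serB b b')) (serB b b')} (h : alKind r b r' b' q = .src) :
    q.1.2.val ≠ 0 ∧ r q.1.1.1.1 = 0 := by
  unfold alKind at h
  split_ifs at h with h1 h2
  exact ⟨h1, h2⟩

omit [Preorder X] [Preorder Y] in
/-- what kind `int` means -/
lemma alKind_int {q : SlotL (USrc (serR r r') (serB b b')) (serB b b')} (h : alKind r b r' b' q = .int) :
    q.1.2.val ≠ 0 ∧ r q.1.1.1.1 ≠ 0 := by
  unfold alKind at h
  split_ifs at h with h1 h2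
  exact ⟨h1, h2⟩

omit [Preorder X] [Preorder Y] in
/-- kind `src`: the first coordinate is a source of `X` -/
lemma src_fst_src {q : SlotL (USrc (serR r r') (serB b b')) (serB b b')} (h : alKind r b r' b' q = .src) :
    USrc r b q.1.1.1.1 := ⟨(alKind_src r b r' b' h).2, (ser_src_blue r b r' b' q.1.1.2.1).1⟩

omit [Preorder X] [Preorder Y] in
/-- kind `src`: the index is below the first blue label -/
lemma src_idx_lt {q : SlotL (USrc (serR r r') (serB b b')) (serB b b')} (_h : alKind r b r' b' q = .src) :
    q.1.2.val < b q.1.1.1.1 := (ser_idx_lt r b r' b' q).1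

omit [Preorder X] [Preorder Y] in
/-- kind `int`: the first coordinate is red-positive and the second is a source of `Y` -/
lemma int_facts {q : SlotL (USrc (serR r r') (serB b b')) (serB b b')} (h : alKind r b r' b' q = .int) :
    1 ≤ r q.1.1.1.1 ∧ r' q.1.1.1.2 = 0 := by
  obtain ⟨-, h2⟩ := alKind_int r b r' b' h
  rcases ser_src_red r b r' b' q.1.1.2.1 with h3 | h3
  · exact absurd h3 h2
  · exact ⟨by omega, h3⟩

omit [Preorder X] [Preorder Y] in
/-- kind `int`: the second coordinate is a source of `Y` -/
lemma int_snd_src {q : SlotL (USrc (serR r r') (serB b b')) (serB b b')} (h : alKind r b r' b' q = .int) :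
    USrc r' b' q.1.1.1.2 := ⟨(int_facts r b r' b' h).2, (ser_src_blue r b r' b' q.1.1.2.1).2⟩

omit [Preorder X] [Preorder Y] in
/-- kind `int`: the index is below the second blue label -/
lemma int_idx_lt {q : SlotL (USrc (serR r r') (serB b b')) (serB b b')} (_h : alKind r b r' b' q = .int) :
    q.1.2.val < b' q.1.1.1.2 := (ser_idx_lt r b r' b' q).2

omit [Preorder X] [Preorder Y] in
/-- a product source with a source first coordinate has a slot of index `0` in `X` -/
lemma zero_fst_src {q : SlotL (USrc (serR r r') (serB b b')) (serB b b')} (h : r q.1.1.1.1 = 0) :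
    USrc r b q.1.1.1.1 := ⟨h, (ser_src_blue r b r' b' q.1.1.2.1).1⟩

omit [Preorder X] [Preorder Y] in
/-- a product source with a source second coordinate has a slot of index `0` in `Y` -/
lemma zero_snd_src {q : SlotL (USrc (serR r r') (serB b b')) (serB b b')} (h : r' q.1.1.1.2 = 0) :
    USrc r' b' q.1.1.1.2 := ⟨h, (ser_src_blue r b r' b' q.1.1.2.1).2⟩

variable {r b r' b'}

/-- **the series assignment of the aligned package**: index `0` to `(α 0 u, α 0 v)`; index `k ≥ 1` with a
source first coordinate to `(f (x, k), α k z)`; index `k ≥ 1` with a red-positive first coordinate to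
`(β k u, g (z, k))` -/
noncomputable def serAssignL (P : PackageL r b) (Q : PackageL r' b')
    (q : SlotL (USrc (serR r r') (serB b b')) (serB b b')) : X × Y :=
  match hk : alKind r b r' b' q with
  | .zero => (P.α 0 q.1.1.1.1, Q.α 0 q.1.1.1.2)
  | .src => (P.f (mkSlot r b q.1.1.1.1 (src_fst_src r b r' b' hk) q.1.2.val (src_idx_lt r b r' b' hk)),
      Q.α q.1.2.val q.1.1.1.2)
  | .int => (P.β q.1.2.val q.1.1.1.1,
      Q.f (mkSlot r' b' q.1.1.1.2 (int_snd_src r b r' b' hk) q.1.2.val (int_idx_lt r b r' b' hk)))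

variable (P : PackageL r b) (Q : PackageL r' b')

/-- the assignment on a slot of kind `zero` -/
lemma serAssignL_zero {q : SlotL (USrc (serR r r') (serB b b')) (serB b b')} (hk : alKind r b r' b' q = .zero) :
    serAssignL P Q q = (P.α 0 q.1.1.1.1, Q.α 0 q.1.1.1.2) := by
  unfold serAssignL
  split
  · rfl
  all_goals (rename_i heq; rw [hk] at heq; cases heq)

/-- the assignment on a slot of kind `src` -/
lemma serAssignL_src {q : SlotL (USrc (serR r r') (serB b b')) (serB b b')} (hk : alKind r b r' b' q = .src) :
    serAssignL P Q q =
      (P.f (mkSlot r b q.1.1.1.1 (src_fst_src r b r' b' hk) q.1.2.val (src_idx_lt r b r' b' hk)),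
        Q.α q.1.2.val q.1.1.1.2) := by
  unfold serAssignL
  split
  all_goals first
    | rfl
    | (rename_i heq; rw [hk] at heq; cases heq)

/-- the assignment on a slot of kind `int` -/
lemma serAssignL_int {q : SlotL (USrc (serR r r') (serB b b')) (serB b b')} (hk : alKind r b r' b' q = .int) :
    serAssignL P Q q =
      (P.β q.1.2.val q.1.1.1.1,
        Q.f (mkSlot r' b' q.1.1.1.2 (int_snd_src r b r' b' hk) q.1.2.val (int_idx_lt r b r' b' hk))) := by
  unfold serAssignL
  split
  all_goals first
    | rfl
    | (rename_i heq; rw [hk] at heq; cases heq)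

end series

end Summit.Ventures.PercRepro2.UHClosure
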